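import Mathlib
import HarnessLib
import HarnessLib.Audit
import Summits.Schanuel.Statement
import HarnessLib.Audit.Status.Attr

/-!
Route: AdelicLogSector

DORMANT since 2026-08-24T08:04:37Z (reconciler: no traction for 6.6 d (last activity item-evidence-added at 2026-08-17T16:53:18Z); parked, not closed — `ledger route dormant route-Schanuel-AdelicLogSector --off` to reactivate) — unstaffed, not closed; items shared with open routes are served there. `ledger route dormant <id> --off` reactivates.

# Route AdelicLogSector — adelic log sector — a real relation among logs of primes must show in
Fermat quotients at every large p; Fermat-quotient genericity forbids it

It suffices to show X = TransferModP ∧ FermatQuotientGenericity ∧ OffPrimeLogSector (card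
adelic-schanuel-fermat-quotients, its (D1)–(D2)/(D5) restricted to the sector Fermat quotients can
see: real logarithms of prime numbers). TransferModP (TRANSFER, mod-p shadow): if an integer
polynomial P vanishes at (log ℓ₁,…,log ℓ_r) for distinct primes ℓᵢ, then its lowest-degree
homogeneous part P_d vanishes mod p at the Fermat-quotient vector (q_p(ℓ₁),…,q_p(ℓ_r)), q_p(ℓ) =
(ℓ^{p−1}−1)/p, for all large p — the first p-adic digit of "the relation also holds among the André
p-adic periods log_p ℓᵢ ≡ −p·q_p(ℓᵢ) (mod p²) of the Kummer motives". FermatQuotientGenericity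
(GENERICITY): for distinct primes ℓᵢ and every nonzero Q ∈ ℤ[X₁..X_r], Q(q_p(ℓ₁),…,q_p(ℓ_r)) ≢ 0
(mod p) for infinitely many p. Together (support PrimeLogSectorOfTransfer, elementary) they give
PrimeLogSector: the logarithms of the primes are algebraically independent over ℚ — the ℚ-rational
real slice of AlgIndepLogs, containing four exponentials for positive rationals and Alaoglu–Erdős.
OffPrimeLogSector is Schanuel relative to K₁ = ℚ(log 2, log 3, log 5, …): the exact complement
(PrimeLogSector ∧ OffPrimeLogSector ⟺ Schanuel; supports SchanuelOfSectors,
OffPrimeLogSectorOfSchanuel).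
Lean: `(∀ (r : ℕ) (ℓ : Fin r → ℕ), (∀ i, (ℓ i).Prime) → Function.Injective ℓ → ∀ (P : MvPolynomial
(Fin r) ℤ) (d : ℕ), (∀ k < d, MvPolynomial.homogeneousComponent k P = 0) → MvPolynomial.aeval (fun i
=> Real.log (ℓ i)) P = 0 → ∃ p₀ : ℕ, ∀ p : ℕ, p₀ ≤ p → p.Prime → MvPolynomial.aeval (fun i => ((((ℓ
i) ^ (p - 1) - 1) / p : ℕ) : ZMod p)) (MvPolynomial.homogeneousComponent d P) = 0) ∧ (∀ (r : ℕ) (ℓ :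
Fin r → ℕ), (∀ i, (ℓ i).Prime) → Function.Injective ℓ → ∀ Q : MvPolynomial (Fin r) ℤ, Q ≠ 0 → ∀ p₀ :
ℕ, ∃ p : ℕ, p₀ ≤ p ∧ p.Prime ∧ MvPolynomial.aeval (fun i => ((((ℓ i) ^ (p - 1) - 1) / p : ℕ) : ZMod
p)) Q ≠ 0) ∧ (∀ (n : ℕ) (x : Fin n → ℂ), LinearIndependent ℚ ((Submodule.span ℚ {z : ℂ | ∃ p : ℕ,
p.Prime ∧ z = ((Real.log (p : ℝ) : ℝ) : ℂ)}).mkQ ∘ x) → (n : Cardinal) ≤ Algebra.trdeg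
↥(IntermediateField.adjoin ℚ {z : ℂ | ∃ p : ℕ, p.Prime ∧ z = ((Real.log (p : ℝ) : ℝ) : ℂ)})
↥(IntermediateField.adjoin ↥(IntermediateField.adjoin ℚ {z : ℂ | ∃ p : ℕ, p.Prime ∧ z = ((Real.log
(p : ℝ) : ℝ) : ℂ)}) (Set.range x ∪ Set.range (Complex.exp ∘ x))))`

## Assembly
Pure logic over the two glue supports (checked sorry-free as `example`s in Sketch.lean):
TransferModP and FermatQuotientGenericity give PrimeLogSector (PrimeLogSectorOfTransfer:
least-degree homogeneous component + genericity), and PrimeLogSector with OffPrimeLogSector gives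
Schanuel (SchanuelOfSectors: GL_n(ℚ)-adapted basis of span z ∩ V, algebraicity of e^{z″}, tower law
— the standard sector reduction, as in LogPatterns.Assembly and
`Literature.NumberTheory.Transcendental.schanuelConjecture_iff_ecl_empty_of_kirby`).

Rationale: WHY THIS LINE. Mechanism (menu 19, adelize with an explicit dictionary): the Kummer 1-motive [ℤ →
𝔾_m, 1 ↦ ℓ] has archimedean period log ℓ and, at every p ∤ ℓ, André p-adic period
log_p(ℓ^{1−p})/(1−p) (arXiv:2207.09213 Ex. 9.6, arXiv:2510.20525 §4.1: Frobenius matrix (1/p)[[1,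
log ℓ^{p−1}],[0, p]]), whose first digit is the Fermat quotient, Ihara's "derivative of ℓ at p" and
−δ_p(ℓ)/ℓ for Buium's p-derivation (Buium2015); period-conjecture philosophy (relations among
periods are motivic, hence hold in every realisation) predicts TRANSFER, and in degree one transfer
is a THEOREM at both ends (HuberWustholz2022 at ∞; the p-adic subgroup theorem for 1-motives,
arXiv:2411.03118) while over ℚ it is even vacuous (unique factorisation), so degree 2 — the
four-exponentials determinant log 2·log 3 − log 5·log 7 — is the first live case. Bombieri1981's
global-relations theorem for G-functions (a relation holding at every place is functional) is the
proved model of the cut "TRANSFER is the whole difficulty"; here the places cannot be tied to one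
G-function value, so the finite places are read prime by prime through Fermat quotients, and the
missing functional-independence input becomes GENERICITY, a congruence statement of Wieferich type
(degree one = infinitely many non-Wieferich primes per base, Silverman1988 under abc) that is NOT a
consequence of Schanuel and that computation can probe. Imported areas: p-adic Hodge theory / p-adic
periods of 1-motives (arithmetic geometry), arithmetic differential calculus (Buium), Wieferich/abc
combinatorics of S-units; no auxiliary functions. What it does that prior routes do not:
ToricPeriods (closed) and LogPatterns carry AlgIndepLogs whole or split it by value patterns over
ℚ̄; this route gives its rational real slice an arithmetic reformulation TRANSFER ∧ GENERICITY with
provable glue, a transfer statement strictly weaker than the sector (support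
TransferOfPrimeLogSector) whose natural habitat is crystalline comparison, and new elementary open
nodes (2×2 Fermat-quotient genericity) outside every catalogued technique class; the negatives index
is empty.

RANKED CRUXES. #0 Target (target) — X = TransferModP ∧ FermatQuotientGenericity ∧ OffPrimeLogSector
as in § Thesis, conjunction INLINED (the gate renders the target before the crux decls);
definitionally the conjunction of the three crux decls (Sketch.lean: Iff.rfl). (why it might fail:
GENERICITY is not implied by Schanuel (a hidden identity among Fermat quotients of fixed primes
kills X with Schanuel alive); TRANSFER may be exactly as hard as the sector it reformulates;
OffPrimeLogSector is most of Schanuel.) [arXiv:2207.09213, Silverman1988, Waldschmidt2005,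
Kirby2010EAEF]
#2 TransferModP (crux) — TRANSFER, mod-p shadow (card C1 in all degrees, primes as bases): for
distinct primes ℓ₁,…,ℓ_r, an integer polynomial P whose homogeneous components below degree d vanish
and with P(log ℓ₁,…,log ℓ_r) = 0 in ℝ has P_d(q_p(ℓ₁),…,q_p(ℓ_r)) ≡ 0 (mod p) for all sufficiently
large primes p, where q_p(ℓ) = (ℓ^{p−1} − 1)/p and P_d is the degree-d homogeneous component. It is
the reduction mod p of "P(log_p ℓ) = 0 in ℚ_p for all large p" via log_p ℓ ≡ −p·q_p(ℓ) (mod p²),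
P(log_p ℓ) ≡ (−p)^d P_d(q_p ℓ) (mod p^{d+1}); implied by PrimeLogSector (support
TransferOfPrimeLogSector), so irrefutable short of refuting Schanuel. [difficulty: open-problem]
(why it might fail: only degree 1 is known (vacuous over ℚ; Baker/Brumer, Huber–Wüstholz and
arXiv:2411.03118 over ℚ̄); nothing transfers an ACCIDENTAL archimedean relation to crystalline
realisations, so it may be exactly as hard as PrimeLogSector, which implies it.) [arXiv:2207.09213,
arXiv:2510.20525, arXiv:2411.03118, HuberWustholz2022, Bombieri1981, Bertolin2002]
#3 FermatQuotientGenericity (crux) — GENERICITY (card C2/(D5) general form): for distinct primes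
ℓ₁,…,ℓ_r and every nonzero Q ∈ ℤ[X₁,…,X_r] there are infinitely many primes p with
Q(q_p(ℓ₁),…,q_p(ℓ_r)) ≢ 0 (mod p) — the Fermat-quotient vectors of fixed primes are Zariski-dense
mod p along infinitely many p. Heuristic: vanishing at p has probability ≤ deg Q/p, so the
exceptional p form a sparse (possibly infinite) set; the 2×2 rung is q_p(2)q_p(3) ≢ q_p(5)q_p(7).
[difficulty: open-problem] (why it might fail: already r = 1, Q = X₁ is "infinitely many
non-Wieferich primes to base ℓ" — open, known only under abc (Silverman1988); degree ≥ 2 is not a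
single Wieferich condition and abc is not known to help; a hidden identity among Fermat quotients
would refute it.) [Silverman1988, doi:10.1090/s0025-5718-97-00791-6, Buium2015, Waldschmidt2004]
#4 OffPrimeLogSector (crux) — Schanuel relative to K₁ = ℚ(log p : p prime) (the complement of the
sector; analogue of LogPatterns.OffLogSector with 𝓛 replaced by V = span_ℚ{log p}): if x₁,…,xₙ ∈ ℂ
are ℚ-linearly independent modulo V, then trdeg over K₁ of K₁(x, eˣ) is ≥ n. Schanuel ⇒ it (support
OffPrimeLogSectorOfSchanuel) and PrimeLogSector ∧ it ⇒ Schanuel (support SchanuelOfSectors).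
[difficulty: open-problem] (why it might fail: it is most of Schanuel (x = (1): e transcendental
over ℚ(log 2, log 3, …); x = (iπ): π is); no transcendence method works relative to an infinitely
generated base; false exactly when Schanuel fails off the sector.) [Kirby2010EAEF, Waldschmidt2005,
BakerTNT1975]
#9 PrimeLogSector (support) — the sector (folklore conjecture, the k = ℚ real slice of AlgIndepLogs
/ LogPatterns.LogSector): logarithms of distinct primes are algebraically independent over ℚ
(finitary form). Not staffed directly: it is reached through PrimeLogSectorOfTransfer; no two
logarithms of primes are known to be algebraically independent (Roy1992 p.22, Waldschmidt2005 Conj.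
1.1). [difficulty: open-problem] [Waldschmidt2005, Roy1992, Pila2022, BakerTNT1975]
#9 PrimeLogSectorOfTransfer (support) — glue (elementary, provable now): TRANSFER ∧ GENERICITY ⇒
PrimeLogSector — a nonzero P ∈ ℚ[X] with P(log ℓ) = 0 may be taken integral; let d be its least
degree with P_d ≠ 0; TransferModP gives P_d(q_p ℓ) ≡ 0 for all large p, contradicting
FermatQuotientGenericity for Q = P_d. [difficulty: provable-now] [Bombieri1981, Waldschmidt2005]
#9 TransferOfPrimeLogSector (support) — calibration (provable now): PrimeLogSector ⇒ TransferModP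
(vacuity: an injective aeval kills P, hence every homogeneous component). Records that TRANSFER is
weaker than the sector and cannot be refuted numerically. [difficulty: provable-now]
[Waldschmidt2005]
#9 SchanuelOfSectors (support) — glue (provable now): PrimeLogSector ∧ OffPrimeLogSector ⇒ Schanuel.
Given ℚ-independent z ∈ ℂⁿ choose P ∈ GL_n(ℚ) with Pz = (z″, z′), z″ a basis of span_ℚ z ∩ V (so z″
= A·(log ℓⱼ) with A rational of full row rank, e^{z″} algebraic) and z′ independent modulo V; trdeg
ℚ(z″, e^{z″}) = trdeg ℚ(z″) = k by PrimeLogSector, trdeg over K₁ of the rest ≥ n − k by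
OffPrimeLogSector; tower law — the LogPatterns.Assembly argument with 𝓛 replaced by V. [difficulty:
provable-now] [Kirby2010EAEF, Waldschmidt2005]
#9 OffPrimeLogSectorOfSchanuel (support) — calibration (provable now): Schanuel ⇒ OffPrimeLogSector,
so the split PrimeLogSector ∧ OffPrimeLogSector ⟺ Schanuel is exact (a transcendence basis of K₁(x,
eˣ)/K₁ and the algebraicity witnesses involve finitely many log p; apply Schanuel to (those log p,
x)). [difficulty: provable-now] [Kirby2010EAEF, Waldschmidt2005]
#9 FermatQuotientHom (support) — the dictionary's unit test (Eisenstein 1850; provable now over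
Mathlib): for p prime and p ∤ a, p ∤ b, q_p(ab) ≡ q_p(a) + q_p(b) (mod p) with q_p(a) = (a^{p−1} −
1)/p — the Fermat quotient is a logarithm mod p; hence a multiplicative dependence (structural rank
drop) forces every Fermat-quotient determinant to vanish. [difficulty: provable-now] [Buium2015,
Silverman1988]
#9 NonWieferichOfGenericity (support) — calibration of GENERICITY's first rung (provable now, r = 1,
Q = X₁): FermatQuotientGenericity ⇒ every prime ℓ has infinitely many non-Wieferich primes p
(ℓ^{p−1} ≢ 1 mod p²) — an open statement, known under abc (Silverman1988); only 1093 and 3511 are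
Wieferich to base 2 below 4·10¹² (doi:10.1090/s0025-5718-97-00791-6). [difficulty: provable-now]
[Silverman1988, doi:10.1090/s0025-5718-97-00791-6]

TWO-LAYER PLAN. Foreseen glued splits (nothing filed now): FermatQuotientGenericity ⇐
GenericityDegreeOne (all linear Q: non-Wieferich primes for rational bases Π ℓᵢ^{cᵢ}) →
GenericityHigherDegree → FermatQuotientGenericity, with a conditional child `ABC →
GenericityDegreeOne` (Silverman1988's argument for rational bases) once the abc constant is
importable; TransferModP ⇐ TransferQuadratic (r ≤ 4, d = 2: the four-exponentials determinants) →
TransferGeneral — only if a crystalline/period-torsor mechanism appears; SchanuelOfSectors ⇐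
SectorBasis (span z ∩ V has a basis of the form A·log ℓ, e^{basis} algebraic) → TowerCount →
SchanuelOfSectors if the prover wants it (k ≤ 3, depth 1).

KILL CRITERIA. (i) ¬FermatQuotientGenericity proved — a polynomial identity Q(q_p(ℓ₁),…,q_p(ℓ_r)) ≡
0 (mod p) for all large p among Fermat quotients of fixed distinct primes — closes the route
`refuted:FermatQuotientGenericity` (Schanuel untouched; the identity is news in itself). (ii)
¬PrimeLogSector or ¬OffPrimeLogSector ⇒ Schanuel is refuted and every route dies. (iii) TransferModP
cannot be refuted without (ii) (TransferOfPrimeLogSector) — refuters should grade it, not compute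
it: if a refuter shows it EQUIVALENT to PrimeLogSector unconditionally (not merely modulo
GENERICITY), the transfer half is a restatement and the route pivots to GENERICITY + the conditional
reading "TRANSFER from the p-adic period conjecture of arXiv:2207.09213 §8" (re-open as conditional
bridge) or closes `superseded` by LogPatterns. (iv) LogPatterns.LogSector (AlgIndepLogs) proved
elsewhere moots PrimeLogSector and with it the purpose of cruxes 2–3 for this summit. (v) Numerical
alarm (not a close): the Cheapest-falsifier count exceeding 5× its Poisson mean sends the route
dormant pending an explanation.

NOT DECOMPOSED YET. The p-adic-logarithm form of TRANSFER (P(log ℓ) = 0 ⇒ P(log_p ℓ) = 0 in ℚ_p;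
needs a `Padic` logarithm API or the tree's `padicLog`, kept out of the import cone) and its
equivalence with TransferModP-for-all-truncation-orders; the motivic reading (kernel of ev_∞ ⊆
kernel of ev_p on the formal period ring of ⊕ Kummer motives, arXiv:2207.09213 §8, arXiv:2411.03118
Ch. 4) — no Lean home for motives; the abc-conditional degree-one genericity (Silverman) and
Graves–Murty-type refinements; S-unit / rational-base versions (q_p extended to ℚ^× by the
homomorphism); the 2×2 special case as its own node (it is an instance, filed later as a child if
TRANSFER stalls); four exponentials for positive rationals and Alaoglu–Erdős as corollaries of
PrimeLogSector (`Nat.AlaogluErdosConjecture` lives outside the import cone; a prover may attach them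
with `--supports PrimeLogSector`); everything inside OffPrimeLogSector (other routes' territory:
EclCore, RigidCore, StokesConstantPi).

CHEAPEST FALSIFIER. A kit job of minutes: for the primes (2,3,5,7) and Q = X₁X₂ − X₃X₄ (the
Fermat-quotient shadow of the four-exponentials determinant log 2·log 3 − log 5·log 7), list the
primes 7 < p ≤ 10⁶ with q_p(2)q_p(3) ≡ q_p(5)q_p(7) (mod p). GENERICITY's heuristic predicts a
Poisson count with mean Σ_{7<p≤10⁶} 1/p ≈ 2.0; every p vanishing kills FermatQuotientGenericity
outright, ≥ 10 sends the route dormant; as a unit test the structural quadruple (2,4,3,9) must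
vanish at every p (FermatQuotientHom). Not run here (hub is compute-free; left to the first
refuter). Degree-one data already in print agree: two Wieferich primes to base 2 below 4·10¹²
(doi:10.1090/s0025-5718-97-00791-6). Lookup falsifier: a printed statement equal to TRANSFER ∧
GENERICITY ⇒ independence of logs (searched, not found — § Novelty).

NUMBERS. q_p : (ℤ/p²)^× → ℤ/p is a homomorphism (Eisenstein); log_p ℓ ≡ −p·q_p(ℓ) (mod p²) for p ≥
3; André p-adic period of the Kummer motive K_ℓ: log_p(ℓ^{1−p})/(1−p) (arXiv:2207.09213 Ex. 9.6),
transcendental by Mahler — the only case of the p-adic period conjecture known (loc. cit.); P(log_p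
ℓ) ≡ (−p)^d P_d(q_p ℓ) (mod p^{d+1}) for P of least degree d. Degree-one transfer: theorem at ∞
(HuberWustholz2022) and at p (arXiv:2411.03118, depths 1–2); degree ≥ 2: nothing at either place (no
two logs of algebraic numbers known algebraically independent, Roy1992 p.22). Wieferich primes base
2: 1093, 3511 only, below 4·10¹² (doi:10.1090/s0025-5718-97-00791-6); abc ⇒ ≫ log X non-Wieferich p
≤ X per base (Silverman1988). Expected exceptional primes for a degree-D genericity instance up to
X: ≈ D·log log X. Items at open: 12 (1 target, 3 cruxes, 7 supports, 1 assembly).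

DEFINITION REQUESTS. None at open: the Fermat quotient is inlined as `((ℓ ^ (p - 1) - 1) / p : ℕ)`
cast to `ZMod p` (exact division by Fermat's little theorem at p ∤ ℓ), and the p-adic logarithm is
avoided by stating TRANSFER through its mod-p shadow. If more Fermat-quotient items are filed, a
grounder may want a `Literature/NumberTheory` notion `fermatQuotient p a : ZMod p` with the
unfolding and homomorphism lemmas. Cite facts wanted later (not load-bearing now): Silverman1988 Thm
1 (abc ⇒ non-Wieferich primes ≫ log X), arXiv:2207.09213 Ex. 9.6 (p-adic period of the Kummer
motive).

Novelty: Searches (2026-08-15): `lit search --hybrid "Fermat quotient algebraic independence logarithms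
p-adic transfer"` (12 held docs: Koblitz 1980, Buium in Dieulefait (ed.) 2015, Baker 1975,
Evertse–Győry 2015 … — none joins Fermat quotients to independence of logarithms); `lit search
"Ancona Fratila algebraic classes mixed characteristic Andre p-adic periods"` (local 5:
arXiv:2301.02411, arXiv:2501.09867, arXiv:2411.03118, arXiv:2210.14001, arXiv:2510.20525; remote
zbmath/crossref: arXiv:2207.09213 = doi:10.1017/s147474802400029x, doi:10.4310/mrl.2013.v20.n5.a2
Chatzistamatiou–Ünver p-adic periods of mixed Tate motives; OpenAlex/S2/arXiv HTTP 429); `lit read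
arxiv:2207.09213` (Ex. 9.6, §8 read), `lit read arxiv:2510.20525` (§4.1 read), `lit read
arxiv:2411.03118` (abstract, Thm 1, Ch. 8 p-adic subgroup theorem located), `lit read
arxiv:math/0312440` (Waldschmidt2004 §1–2: p-adic analogue of Gel'fond's conjecture ⇒ Leopoldt; abc
↔ measures of independence of logarithms); `lit search --hybrid "conjecture logarithms of algebraic
numbers algebraically independent log 2 log 3 open problem"` (8 held: Alladi (ed.),
Nesterenko–Philippon 2001, Baker 1975, Huber–Wüstholz 2022 …); `lit frontier Schanuel --since 2020`
(30 rows: p-adic unlikely intersections arXiv:2504.10611, GPC for CM Kummer surfaces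
arXiv:2303.05030 — nothing adelic on logs); `lit bridges Schanuel --cross any` (30 rows, ABC bridges
via Baker–Wüstholz/unit equations only); `lit galaxy search "Fermat quotient" --star all` (2  [refs: 10.1017/s147474802400029x, 10.4310/mrl.2013.v20.n5.a2, 10.1090/s0025-5718-97-00791-6, 2301.02411, 2501.09867, 2411.03118, 2210.14001, 2510.20525, 2207.09213, math/0312440, 2504.10611, 2303.05030, 1103.3907, doi:10.1017/s147474802400029x, doi:10.4310/mrl.2013.v20.n5.a2, arxiv:2207.09213, arxiv:2510.20525, arxiv:2411.03118, arxiv:math/0312440, doi:10.1090/s0025-5718-97-00791-6, Waldschmidt2004, Hube]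

Barriers (technique_class: adelic-methods fermat-quotients p-adic-periods): - technique_class: adelic-methods fermat-quotients p-adic-periods
- Literature.Barriers.Schanuel.PeriodConjectureOverQbarScope: engaged and accepted — the route lives
in the toric (Kummer) sector over ℚ, exactly the scope the barrier assigns to period-conjecture
methods, and concedes e, π to OffPrimeLogSector (most of Schanuel, rank 4); inside the scope it asks
for LESS than GPC at ∞ (transfer of relations, implied by the sector — TransferOfPrimeLogSector) and
adds a finite-place input (Fermat quotients, GENERICITY) that no ℚ̄-period method uses; whether
"less" is genuinely less is crux 2's grading question.
- Literature.Barriers.Schanuel.AlgebraicIndependenceOfLogarithms: not evaded — PrimeLogSector is a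
sub-case of the barrier's conjecture and nothing here climbs from Baker's degree one; the route
records that its own degree-one rung is HARDER adelically than archimedeanly
(NonWieferichOfGenericity is open, Baker is a theorem) and bets on degree ≥ 2 genericity being
abc-grade rather than Schanuel-grade.
- Literature.Barriers.Schanuel.LinearSubgroupMethodLimit: not engaged — no auxiliary function, no
linear-subgroup or Schneider–Lang step anywhere in the route; p-adic six exponentials / LST would
only re-prove rank ≥ structural-rank/2 place by place and is not used.
- Literature.Barriers.Schanuel.LargeTranscendenceDegree: not engaged — no d×ℓ grid with technical
hypothesis; the sector statement is reached by transfer + congruences, not by transcendence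
measures.
- Literature

History (route lifecycle, newest last):
- 2026-08-16T02:18:11Z · AUTO-CRUX: 1 conjecture-grade item(s) promoted to crux (PrimeLogSector) — refuter vetting / tiering apply (operator:999:1362873)
- 2026-08-24T08:04:37Z · DORMANT — reconciler: no traction for 6.6 d (last activity item-evidence-added at 2026-08-17T16:53:18Z); parked, not closed — `ledger route dormant route-Schanuel-AdelicL (operator:999:3063692)

sub-problem: Schanuel · status: dormant · opened planner-plancard-Schanuel-Schanuel-adelic-sch-c0f0bd9d-0 2026-08-15T12:01:48Z · rev 1 · ledger route-Schanuel-AdelicLogSector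
GENERATED by the gate from the ledger (D-0016/17). Provers cite these decls: `theorem foo : Summit.Schanuel.Schanuel.Theses.AdelicLogSector.<Decl> := …` in Summits/Schanuel/Schanuel/Theorems/<Name>.lean.
-/

namespace Summit.Schanuel.Schanuel.Theses.AdelicLogSector

open scoped BigOperators Topology Manifold Classical MeasureTheory ProbabilityTheory Matrix InnerProductSpace ComplexConjugate ContinuousMap
open Filter Set Function TopologicalSpace MeasureTheory

attribute [summit_statement] _root_.Schanuel

open Literature.Periods

/-- item stmt-Schanuel-7087 · target · rank 0 · open · by planner
why it might fail: GENERICITY is not implied by Schanuel (a hidden identity among Fermat quotients of fixed primes kills X with Schanuel alive); TRANSFER may be exactly as hard as the sector it reformulates; OffPrimeLogSector is most of Schanuel.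
sources: arXiv:2207.09213, Silverman1988, Waldschmidt2005, Kirby2010EAEF
[target] X = TransferModP ∧ FermatQuotientGenericity ∧ OffPrimeLogSector as in § Thesis, conjunction
INLINED (the gate renders the target before the crux decls); definitionally the conjunction of the
three crux decls (Sketch.lean: Iff.rfl). -/
@[route_item "route-Schanuel-AdelicLogSector"]
def Target : Prop :=
  (∀ (r : ℕ) (ℓ : Fin r → ℕ), (∀ i, (ℓ i).Prime) → Function.Injective ℓ → ∀ (P : MvPolynomial (Fin r) ℤ) (d : ℕ), (∀ k < d, MvPolynomial.homogeneousComponent k P = 0) → MvPolynomial.aeval (fun i => Real.log (ℓ i)) P = 0 → ∃ p₀ : ℕ, ∀ p : ℕ, p₀ ≤ p → p.Prime → MvPolynomial.aeval (fun i => ((((ℓ i) ^ (p - 1) - 1) / p : ℕ) : ZMod p)) (MvPolynomial.homogeneousComponent d P) = 0) ∧ (∀ (r : ℕ) (ℓ : Fin r → ℕ), (∀ i, (ℓ i).Prime) → Function.Injective ℓ → ∀ Q : MvPolynomial (Fin r) ℤ, Q ≠ 0 → ∀ p₀ : ℕ, ∃ p : ℕ, p₀ ≤ p ∧ p.Prime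 ∧ MvPolynomial.aeval (fun i => ((((ℓ i) ^ (p - 1) - 1) / p : ℕ) : ZMod p)) Q ≠ 0) ∧ (∀ (n : ℕ) (x : Fin n → ℂ), LinearIndependent ℚ ((Submodule.span ℚ {z : ℂ | ∃ p : ℕ, p.Prime ∧ z = ((Real.log (p : ℝ) : ℝ) : ℂ)}).mkQ ∘ x) → (n : Cardinal) ≤ Algebra.trdeg ↥(IntermediateField.adjoin ℚ {z : ℂ | ∃ p : ℕ, p.Prime ∧ z = ((Real.log (p : ℝ) : ℝ) : ℂ)}) ↥(IntermediateField.adjoin ↥(IntermediateField.adjoin ℚ {z : ℂ | ∃ p : ℕ, p.Prime ∧ z = ((Real.log (p : ℝ) : ℝ) : ℂ)}) (Set.range x ∪ Set.range (Complex.exp ∘ x))))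

/-- item stmt-Schanuel-7088 · crux · rank 2 · open · by planner
why it might fail: only degree 1 is known (vacuous over ℚ; Baker/Brumer, Huber–Wüstholz and arXiv:2411.03118 over ℚ̄); nothing transfers an ACCIDENTAL archimedean relation to crystalline realisations, so it may be exactly as hard as PrimeLogSector, which implies it.
sources: arXiv:2207.09213, arXiv:2510.20525, arXiv:2411.03118, HuberWustholz2022, Bombieri1981, Bertolin2002
[crux] TRANSFER, mod-p shadow (card C1 in all degrees, primes as bases): for distinct primes
ℓ₁,…,ℓ_r, an integer polynomial P whose homogeneous components below degree d vanish and with P(log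
ℓ₁,…,log ℓ_r) = 0 in ℝ has P_d(q_p(ℓ₁),…,q_p(ℓ_r)) ≡ 0 (mod p) for all sufficiently large primes p,
where q_p(ℓ) = (ℓ^{p−1} − 1)/p and P_d is the degree-d homogeneous component. It is the reduction
mod p of "P(log_p ℓ) = 0 in ℚ_p for all large p" via log_p ℓ ≡ −p·q_p(ℓ) (mod p²), P(log_p ℓ) ≡
(−p)^d P_d(q_p ℓ) (mod p^{d+1}); implied by PrimeLogSector (support TransferOfPrimeLogSector), so
irrefutable short of refuting Schanuel. [difficulty: open-problem] -/
@[route_item "route-Schanuel-AdelicLogSector", crux]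
def TransferModP : Prop :=
  ∀ (r : ℕ) (ℓ : Fin r → ℕ), (∀ i, (ℓ i).Prime) → Function.Injective ℓ → ∀ (P : MvPolynomial (Fin r) ℤ) (d : ℕ), (∀ k < d, MvPolynomial.homogeneousComponent k P = 0) → MvPolynomial.aeval (fun i => Real.log (ℓ i)) P = 0 → ∃ p₀ : ℕ, ∀ p : ℕ, p₀ ≤ p → p.Prime → MvPolynomial.aeval (fun i => ((((ℓ i) ^ (p - 1) - 1) / p : ℕ) : ZMod p)) (MvPolynomial.homogeneousComponent d P) = 0

/-- item stmt-Schanuel-7089 · crux · rank 3 · open · by planner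
why it might fail: already r = 1, Q = X₁ is "infinitely many non-Wieferich primes to base ℓ" — open, known only under abc (Silverman1988); degree ≥ 2 is not a single Wieferich condition and abc is not known to help; a hidden identity among Fermat quotients would refute it.
sources: Silverman1988, doi:10.1090/s0025-5718-97-00791-6, Buium2015, Waldschmidt2004
[crux] GENERICITY (card C2/(D5) general form): for distinct primes ℓ₁,…,ℓ_r and every nonzero Q ∈
ℤ[X₁,…,X_r] there are infinitely many primes p with Q(q_p(ℓ₁),…,q_p(ℓ_r)) ≢ 0 (mod p) — the
Fermat-quotient vectors of fixed primes are Zariski-dense mod p along infinitely many p. Heuristic: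
vanishing at p has probability ≤ deg Q/p, so the exceptional p form a sparse (possibly infinite)
set; the 2×2 rung is q_p(2)q_p(3) ≢ q_p(5)q_p(7). [difficulty: open-problem] -/
@[route_item "route-Schanuel-AdelicLogSector", crux]
def FermatQuotientGenericity : Prop :=
  ∀ (r : ℕ) (ℓ : Fin r → ℕ), (∀ i, (ℓ i).Prime) → Function.Injective ℓ → ∀ Q : MvPolynomial (Fin r) ℤ, Q ≠ 0 → ∀ p₀ : ℕ, ∃ p : ℕ, p₀ ≤ p ∧ p.Prime ∧ MvPolynomial.aeval (fun i => ((((ℓ i) ^ (p - 1) - 1) / p : ℕ) : ZMod p)) Q ≠ 0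

/-- item stmt-Schanuel-7090 · crux · rank 4 · open · by planner
why it might fail: it is most of Schanuel (x = (1): e transcendental over ℚ(log 2, log 3, …); x = (iπ): π is); no transcendence method works relative to an infinitely generated base; false exactly when Schanuel fails off the sector.
sources: Kirby2010EAEF, Waldschmidt2005, BakerTNT1975
[crux] Schanuel relative to K₁ = ℚ(log p : p prime) (the complement of the sector; analogue of
LogPatterns.OffLogSector with 𝓛 replaced by V = span_ℚ{log p}): if x₁,…,xₙ ∈ ℂ are ℚ-linearly
independent modulo V, then trdeg over K₁ of K₁(x, eˣ) is ≥ n. Schanuel ⇒ it (support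
OffPrimeLogSectorOfSchanuel) and PrimeLogSector ∧ it ⇒ Schanuel (support SchanuelOfSectors).
[difficulty: open-problem] -/
@[route_item "route-Schanuel-AdelicLogSector", crux]
def OffPrimeLogSector : Prop :=
  ∀ (n : ℕ) (x : Fin n → ℂ), LinearIndependent ℚ ((Submodule.span ℚ {z : ℂ | ∃ p : ℕ, p.Prime ∧ z = ((Real.log (p : ℝ) : ℝ) : ℂ)}).mkQ ∘ x) → (n : Cardinal) ≤ Algebra.trdeg ↥(IntermediateField.adjoin ℚ {z : ℂ | ∃ p : ℕ, p.Prime ∧ z = ((Real.log (p : ℝ) : ℝ) : ℂ)}) ↥(IntermediateField.adjoin ↥(IntermediateField.adjoin ℚ {z : ℂ | ∃ p : ℕ, p.Prime ∧ z = ((Real.log (p : ℝ) : ℝ) : ℂ)}) (Set.range x ∪ Set.range (Complex.exp ∘ x)))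

/-- item stmt-Schanuel-7091 · crux (kind.auto-crux: conjecture-grade) · rank 9 · open · by planner
why it might fail: auto-crux — conjecture-grade statement (docstring avows it ('conjecture')); it is open, so it may simply be false
sources: Waldschmidt2005, Roy1992, Pila2022, BakerTNT1975
[support] the sector (folklore conjecture, the k = ℚ real slice of AlgIndepLogs /
LogPatterns.LogSector): logarithms of distinct primes are algebraically independent over ℚ (finitary
form). Not staffed directly: it is reached through PrimeLogSectorOfTransfer; no two logarithms of
primes are known to be algebraically independent (Roy1992 p.22, Waldschmidt2005 Conj. 1.1).
[difficulty: open-problem] -/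
@[route_item "route-Schanuel-AdelicLogSector"]
def PrimeLogSector : Prop :=
  ∀ (r : ℕ) (ℓ : Fin r → ℕ), (∀ i, (ℓ i).Prime) → Function.Injective ℓ → AlgebraicIndependent ℚ (fun i => Real.log (ℓ i))

/-- item stmt-Schanuel-7092 · support · rank 9 · open · by planner
sources: Bombieri1981, Waldschmidt2005
[support] glue (elementary, provable now): TRANSFER ∧ GENERICITY ⇒ PrimeLogSector — a nonzero P ∈
ℚ[X] with P(log ℓ) = 0 may be taken integral; let d be its least degree with P_d ≠ 0; TransferModP
gives P_d(q_p ℓ) ≡ 0 for all large p, contradicting FermatQuotientGenericity for Q = P_d.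
[difficulty: provable-now] -/
@[route_item "route-Schanuel-AdelicLogSector", crux]
def PrimeLogSectorOfTransfer : Prop :=
  TransferModP → FermatQuotientGenericity → PrimeLogSector

/-- item stmt-Schanuel-7093 · support · rank 9 · open · by planner
sources: Waldschmidt2005
[support] calibration (provable now): PrimeLogSector ⇒ TransferModP (vacuity: an injective aeval
kills P, hence every homogeneous component). Records that TRANSFER is weaker than the sector and
cannot be refuted numerically. [difficulty: provable-now] -/
@[route_item "route-Schanuel-AdelicLogSector"]
def TransferOfPrimeLogSector : Prop :=
  PrimeLogSector → TransferModP

/-- item stmt-Schanuel-7094 · support · rank 9 · open · by planner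
sources: Kirby2010EAEF, Waldschmidt2005
[support] glue (provable now): PrimeLogSector ∧ OffPrimeLogSector ⇒ Schanuel. Given ℚ-independent z
∈ ℂⁿ choose P ∈ GL_n(ℚ) with Pz = (z″, z′), z″ a basis of span_ℚ z ∩ V (so z″ = A·(log ℓⱼ) with A
rational of full row rank, e^{z″} algebraic) and z′ independent modulo V; trdeg ℚ(z″, e^{z″}) =
trdeg ℚ(z″) = k by PrimeLogSector, trdeg over K₁ of the rest ≥ n − k by OffPrimeLogSector; tower law
— the LogPatterns.Assembly argument with 𝓛 replaced by V. [difficulty: provable-now] -/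
@[route_item "route-Schanuel-AdelicLogSector", crux]
def SchanuelOfSectors : Prop :=
  PrimeLogSector → OffPrimeLogSector → Schanuel

/-- item stmt-Schanuel-7095 · support · rank 9 · open · by planner
sources: Kirby2010EAEF, Waldschmidt2005
[support] calibration (provable now): Schanuel ⇒ OffPrimeLogSector, so the split PrimeLogSector ∧
OffPrimeLogSector ⟺ Schanuel is exact (a transcendence basis of K₁(x, eˣ)/K₁ and the algebraicity
witnesses involve finitely many log p; apply Schanuel to (those log p, x)). [difficulty:
provable-now] -/
@[route_item "route-Schanuel-AdelicLogSector"]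
def OffPrimeLogSectorOfSchanuel : Prop :=
  Schanuel → OffPrimeLogSector

/-- item stmt-Schanuel-7096 · support · rank 9 · open · by planner
sources: Buium2015, Silverman1988
[support] the dictionary's unit test (Eisenstein 1850; provable now over Mathlib): for p prime and p
∤ a, p ∤ b, q_p(ab) ≡ q_p(a) + q_p(b) (mod p) with q_p(a) = (a^{p−1} − 1)/p — the Fermat quotient is
a logarithm mod p; hence a multiplicative dependence (structural rank drop) forces every
Fermat-quotient determinant to vanish. [difficulty: provable-now] -/
@[route_item "route-Schanuel-AdelicLogSector"]
def FermatQuotientHom : Prop :=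
  ∀ (p a b : ℕ), p.Prime → ¬ p ∣ a → ¬ p ∣ b → ((((a * b) ^ (p - 1) - 1) / p : ℕ) : ZMod p) = (((a ^ (p - 1) - 1) / p : ℕ) : ZMod p) + (((b ^ (p - 1) - 1) / p : ℕ) : ZMod p)

/-- item stmt-Schanuel-7097 · support · rank 9 · open · by planner
sources: Silverman1988, doi:10.1090/s0025-5718-97-00791-6
[support] calibration of GENERICITY's first rung (provable now, r = 1, Q = X₁):
FermatQuotientGenericity ⇒ every prime ℓ has infinitely many non-Wieferich primes p (ℓ^{p−1} ≢ 1 mod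
p²) — an open statement, known under abc (Silverman1988); only 1093 and 3511 are Wieferich to base 2
below 4·10¹² (doi:10.1090/s0025-5718-97-00791-6). [difficulty: provable-now] -/
@[route_item "route-Schanuel-AdelicLogSector"]
def NonWieferichOfGenericity : Prop :=
  FermatQuotientGenericity → ∀ ℓ : ℕ, ℓ.Prime → {p : ℕ | p.Prime ∧ ¬ Nat.ModEq (p ^ 2) (ℓ ^ (p - 1)) 1}.Infinite

/-- item stmt-Schanuel-7098 · assembly · rank 1 · open · by planner
sources: Waldschmidt2005, Kirby2010EAEF
[assembly] TransferModP → FermatQuotientGenericity → OffPrimeLogSector → Schanuel. -/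
@[route_item "route-Schanuel-AdelicLogSector"]
def Assembly : Prop :=
  TransferModP → FermatQuotientGenericity → OffPrimeLogSector → Schanuel

/-! D-0027 §2.1 — DECIDING THEOREM (planner-authored via `route open/edit --closes-file`; by planner-rbadge-Schanuel-AdelicLogSector-2acd445b-g2-0 2026-08-15T16:13:38Z):
its hypotheses are this route's items and its conclusion the sub-problem Statement (glue_lint), and it elaborates with this file. -/

/-- D-0027 §2.1 deciding theorem of route AdelicLogSector. Load-bearing items only: the three cruxes
`TransferModP` (rank 2, TRANSFER mod p), `FermatQuotientGenericity` (rank 3, GENERICITY) and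
`OffPrimeLogSector` (rank 4, Schanuel relative to ℚ(log p : p prime)), plus the two provable-now glue
supports `PrimeLogSectorOfTransfer` (TRANSFER ∧ GENERICITY ⇒ logs of primes algebraically independent:
least-degree homogeneous component + genericity) and `SchanuelOfSectors` (sector ∧ off-sector ⇒ Schanuel:
GL_n(ℚ)-adapted basis, algebraicity of e^{z″}, tower law). The calibration supports
(`TransferOfPrimeLogSector`, `OffPrimeLogSectorOfSchanuel`, `FermatQuotientHom`, `NonWieferichOfGenericity`),
`Target` and `Assembly` are not load-bearing and are deliberately not hypotheses. Pure logic. -/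
@[closes "route-Schanuel-AdelicLogSector"] theorem closes (hTransfer : TransferModP) (hGenericity : FermatQuotientGenericity)
    (hOff : OffPrimeLogSector) (hSectorOfTransfer : PrimeLogSectorOfTransfer)
    (hSchanuelOfSectors : SchanuelOfSectors) : _root_.Schanuel :=
  hSchanuelOfSectors (hSectorOfTransfer hTransfer hGenericity) hOff

end Summit.Schanuel.Schanuel.Theses.AdelicLogSector
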